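import Summits.BirchSwinnertonDyer.BirchSwinnertonDyer.Theorems.AlignedTransportAtTwoMainConjectureTransportAlignedAtTwoAddTwistTame
import HarnessLib

/-!
# Route `AlignedTransportAtTwo`, crux C1 `MainConjectureTransportAlignedAtTwo` (stmt-BirchSwinnertonDyer-22296), line `birth` —
# the BOTH-ADDITIVE twist sub-cell, part 2b (CONGRUENCE): `L₂(f,α,χ_ℓ) ∈ Λ` and
# `L₂(f,α,χ_ℓ) ≡ L₂(f,α,𝟙_ℓ) = −(1+T)^{f_ℓ}·L₂(f,α) (mod 2Λ)` at a prime tame level `ℓ` with `ℓ² ∣ N`, `a_ℓ = 0`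

HONEST FRAMING (cell `bsd-f1-sign2`, WIDTH-5 attach seat `bsd-line-att-p4` g9, under the lead `bsd-line-att-p1`). BSD is NOT
proved; C1 is NOT closed. THEOREMS ONLY; nothing asserted; `--supports stmt-BirchSwinnertonDyer-22296 --as helper`. Sequel of
`…AddTwistCusp` / `…AddTwistHalfSums` / `…AddTwistTame` (§2 there: `‖Σ_{χ(b)=ε} μ_{f,α,ℓ}((a + 2ⁿℤ₂) × {b})‖₂ ≤ 2`).

For `E = W/ℚ` globally minimal, good ordinary at `2`, with `E[2]` irreducible, `f` its newform (level `N`), an odd prime `ℓ`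
with `ℓ² ∣ N` and `a_ℓ(f) = 0` (e.g. an ADDITIVE prime of `E`, `N = N_E`), and a `ℤ`-valued even character `χ` mod `ℓ`:
* §3 `norm_padicLRiemannSumTame_le` — `‖RS(χ)‖ ≤ 1`, `‖RS(𝟙_ℓ)‖ ≤ 1`, `‖RS(χ) − RS(𝟙_ℓ)‖ ≤ ‖2‖` (`Δ`-doubling
  `padicLRiemannSumTame_two_of_even` + the `b`-sums `Σ_b χ(b)μ_b = Σ_{χ=1}μ − Σ_{χ=−1}μ`, `Σ_b 𝟙(b)μ_b = Σ_{χ=1}μ + Σ_{χ=−1}μ`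
  at the unit classes `γˢ`); `exists_iwasawa_pair_map_toZMod_eq_two_of_sq_dvd` — `L₂(f,α,χ), L₂(f,α,𝟙_ℓ) ∈ Λ` with equal
  reductions mod `2` (the odd Eisenstein prime comes from `not_irreducible_of_frobeniusTrace_congr_holds`);
* §4 `iwasawaToPowerSeries_neg_binomialSeries_mul_eq_padicLFunctionTame_one` — the depletion at a prime DIVIDING the level with
  `a_ℓ = 0`: `L₂(f,α,𝟙_ℓ) = −(1+T)^{f_ℓ}·L₂(f,α)` (`iwasawaToPowerSeries_prod_tameEulerFactor_mul_sqfreeAt` at `S = {ℓ}`), and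
  **`exists_iwasawa_padicLFunctionTame_congr_two_of_sq_dvd`: `L₂(f,α,χ_ℓ) ≡ u·L₂(f,α) (mod 2Λ)` with `u ∈ Λˣ` and NO Euler
  factor** — the analytic Kida step at `2` with ZERO local terms at a both-additive prime (Matsuno 2000 Thm. 3.1 with `ε(ℓ) = 0`,
  `P_ℓ = 1`; the both-additive companion of `exists_iwasawa_padicLFunctionTame_congr_two_sqfreeAt`).

References: [MazurTateTeitelbaum1986Invent] §I.4 (4.2), §I.10–§I.13; [Matsuno2000] Lemmas 3.2–3.3, Thm. 3.1 (pp. 86–88);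
[GreenbergVatsal2000] Prop. (3.7), §1 (8); [DarmonDiamondTaylor1995] Prop. 2.6(b).
-/

set_option autoImplicit false
set_option linter.dupNamespace false

noncomputable section

open scoped Classical MatrixGroups ModularForm

open CongruenceSubgroup Filter Topology PowerSeries
open Literature.NumberTheory.EllipticCurves Literature.NumberTheory.EllipticCurves.ModularForms
open Literature.NumberTheory.EllipticCurves.GreenbergVatsal2000
open Summit.BirchSwinnertonDyer.BirchSwinnertonDyer.Theorems.AlignedTransportAtTwoAddTwistCusp
open Summit.BirchSwinnertonDyer.BirchSwinnertonDyer.Theorems.AlignedTransportAtTwoAddTwistHalfSums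
open Summit.BirchSwinnertonDyer.BirchSwinnertonDyer.Theorems.AlignedTransportAtTwoAddTwistTame

namespace Summit.BirchSwinnertonDyer.BirchSwinnertonDyer.Theorems.AlignedTransportAtTwoAddTwistCongruence

/-! ## §3 The Riemann sums and the coefficients of `L₂(f,α,χ)`, `L₂(f,α,𝟙_ℓ)` -/

section Riemann

variable {N : ℕ} [NeZero N] (f : CuspForm (Gamma0 N) 2) {ℓ : ℕ} [Fact ℓ.Prime]
  {W : WeierstrassCurve ℚ} [W.IsElliptic] [W.IsGloballyMinimal]

omit [NeZero N] in
/-- Splitting a character-weighted sum over `ℤ/ℓ`: `Σ_b χ(b)·g(b) = Σ_{χ(b)=1} g(b) − Σ_{χ(b)=−1} g(b)` (`χ(0) = 0`, `χ = ±1` on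
the units). [folklore] -/
theorem sum_intCast_mulChar_mul_eq (χ : MulChar (ZMod ℓ) ℤ) (g : ZMod ℓ → ℚ_[2]) :
    ∑ b : ZMod ℓ, ((χ b : ℤ) : ℚ_[2]) * g b =
      ∑ b ∈ Finset.univ.filter (fun b : ZMod ℓ ↦ χ b = 1), g b -
        ∑ b ∈ Finset.univ.filter (fun b : ZMod ℓ ↦ χ b = -1), g b := by
  have hχ0 : χ 0 = 0 := χ.map_nonunit not_isUnit_zero
  rw [Finset.sum_filter, Finset.sum_filter, ← Finset.sum_sub_distrib]
  refine Finset.sum_congr rfl fun b _ ↦ ?_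
  by_cases hb : b = 0
  · rw [hb, hχ0, if_neg (by norm_num), if_neg (by norm_num)]; simp
  · rcases mulChar_apply_eq_one_or_eq_neg_one χ hb with h | h
    · rw [h, if_pos rfl, if_neg (by norm_num)]; simp
    · rw [h, if_neg (by norm_num), if_pos rfl]; simp

omit [NeZero N] in
/-- Splitting the trivial-character sum over `ℤ/ℓ`: `Σ_b 𝟙_ℓ(b)·g(b) = Σ_{χ(b)=1} g(b) + Σ_{χ(b)=−1} g(b)` for any `ℤ`-valued
character `χ` mod `ℓ` (the units are `{χ = 1} ⊔ {χ = −1}`). [folklore] -/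
theorem sum_one_mul_eq (χ : MulChar (ZMod ℓ) ℤ) (g : ZMod ℓ → ℚ_[2]) :
    ∑ b : ZMod ℓ, (1 : DirichletCharacter ℚ_[2] ℓ) b * g b =
      ∑ b ∈ Finset.univ.filter (fun b : ZMod ℓ ↦ χ b = 1), g b +
        ∑ b ∈ Finset.univ.filter (fun b : ZMod ℓ ↦ χ b = -1), g b := by
  have hχ0 : χ 0 = 0 := χ.map_nonunit not_isUnit_zero
  rw [Finset.sum_filter, Finset.sum_filter, ← Finset.sum_add_distrib]
  refine Finset.sum_congr rfl fun b _ ↦ ?_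
  by_cases hb : b = 0
  · rw [hb, hχ0, if_neg (by norm_num), if_neg (by norm_num), MulChar.map_nonunit _ not_isUnit_zero]; simp
  · have hu : IsUnit b := isUnit_iff_ne_zero.mpr hb
    rw [MulChar.one_apply hu]
    rcases mulChar_apply_eq_one_or_eq_neg_one χ hb with h | h
    · rw [h, if_pos rfl, if_neg (by norm_num)]; simp
    · rw [h, if_neg (by norm_num), if_pos rfl]; simp

/-- `γ^s = 5^s` is a unit mod `2ⁿ⁺²`; private helper. [folklore] -/
private theorem isUnit_cyclotomicGenerator_pow (n s : ℕ) :
    IsUnit ((cyclotomicGenerator 2 : ZMod (2 ^ (n + 2))) ^ s) := by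
  refine IsUnit.pow s ?_
  rw [cyclotomicGenerator_two, ZMod.isUnit_iff_coprime]
  exact Nat.Coprime.pow_right _ (by norm_num)

/-- **The Riemann sums of `L₂(f,α,χ)` and `L₂(f,α,𝟙_ℓ)` have norm `≤ 1`, and differ by at most `‖2‖`**, at a prime tame level
`ℓ` with `ℓ² ∣ N`, `a_ℓ(f) = 0`, for the `ℚ₂`-valued EVEN character `χ` (values `0, ±1`) and the unit root `α` of `E = W`
good ordinary at `2`, given one odd prime `q ∤ N` with `a_q − q − 1` odd: the `Δ`-doubling `padicLRiemannSumTame_two_of_even` and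
§2 at the unit classes `γˢ`. [cite: MazurTateTeitelbaum1986Invent, §I.13 (pp. 18–19)] [cite: Matsuno2000, Lemma 3.2 (p. 87)] -/
theorem norm_padicLRiemannSumTame_le (hord : IsOrdinaryAt W 2) (hf : IsNewformOf W f)
    (hℓN : ℓ ^ 2 ∣ N) (haℓ : cuspCoeff f ℓ = 0) {q : ℕ} [Fact q.Prime] (hqN : ¬ q ∣ N) {aq : ℤ}
    (haq : cuspCoeff f q = aq) (hodd : ¬ (2 : ℤ) ∣ aq - q - 1) (χ : MulChar (ZMod ℓ) ℤ) (hχ : χ (-1) = 1)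
    (k n : ℕ) :
    ‖padicLRiemannSumTame f ℓ (unitRoot W 2 : ℚ_[2])
        ((χ.ringHomComp (Int.castRingHom ℚ)).ringHomComp (Rat.castHom ℚ_[2])) k n‖ ≤ 1 ∧
      ‖padicLRiemannSumTame f ℓ (unitRoot W 2 : ℚ_[2]) (1 : DirichletCharacter ℚ_[2] ℓ) k n‖ ≤ 1 ∧
      ‖padicLRiemannSumTame f ℓ (unitRoot W 2 : ℚ_[2])
          ((χ.ringHomComp (Int.castRingHom ℚ)).ringHomComp (Rat.castHom ℚ_[2])) k n -
        padicLRiemannSumTame f ℓ (unitRoot W 2 : ℚ_[2]) (1 : DirichletCharacter ℚ_[2] ℓ) k n‖ ≤ ‖(2 : ℚ_[2])‖ := by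
  have hℓ : ℓ.Prime := Fact.out
  have h2N : ¬ 2 ∣ N := not_dvd_level_of_isNewformOf hf hord.1
  have hℓ2 : ℓ.Coprime 2 := (Nat.coprime_primes hℓ Nat.prime_two).mpr (by
    rintro rfl; exact h2N ((dvd_pow_self 2 two_ne_zero).trans hℓN))
  set α : ℚ_[2] := (unitRoot W 2 : ℚ_[2]) with hα
  set χQ : DirichletCharacter ℚ_[2] ℓ := (χ.ringHomComp (Int.castRingHom ℚ)).ringHomComp (Rat.castHom ℚ_[2]) with hχQ
  have hχQapp : ∀ b : ZMod ℓ, χQ b = ((χ b : ℤ) : ℚ_[2]) := fun b ↦ by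
    rw [hχQ, MulChar.ringHomComp_apply, MulChar.ringHomComp_apply]; simp
  have hχQeven : χQ.Even := by
    show χQ (-1) = 1
    rw [hχQapp, hχ, Int.cast_one]
  have h1even : (1 : DirichletCharacter ℚ_[2] ℓ).Even := by
    show (1 : DirichletCharacter ℚ_[2] ℓ) (-1) = 1
    rw [MulChar.one_apply (isUnit_one.neg)]
  have h2 : ‖(2 : ℚ_[2])‖ = (2 : ℝ)⁻¹ := by
    have h := Padic.norm_p (p := 2); simpa using h
  -- the `b`-sums at the unit classes `γˢ`
  set μ : ℕ → ZMod ℓ → ℚ_[2] := fun s b ↦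
    msdMeasureTame f ℓ α (n + 2) ((cyclotomicGenerator 2 : ZMod (2 ^ (n + 2))) ^ s) b with hμ
  have hP : ∀ s : ℕ, ‖∑ b ∈ Finset.univ.filter (fun b : ZMod ℓ ↦ χ b = 1), μ s b‖ ≤ 2 := fun s ↦
    norm_sum_filter_msdMeasureTame_le_two f hord hf hℓN haℓ hqN haq hodd χ (Or.inl rfl) (n + 2)
      (isUnit_cyclotomicGenerator_pow n s)
  have hM : ∀ s : ℕ, ‖∑ b ∈ Finset.univ.filter (fun b : ZMod ℓ ↦ χ b = -1), μ s b‖ ≤ 2 := fun s ↦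
    norm_sum_filter_msdMeasureTame_le_two f hord hf hℓN haℓ hqN haq hodd χ (Or.inr rfl) (n + 2)
      (isUnit_cyclotomicGenerator_pow n s)
  have hχsum : ∀ s : ℕ, ‖∑ b : ZMod ℓ, χQ b * μ s b‖ ≤ 2 := fun s ↦ by
    simp_rw [hχQapp]
    rw [sum_intCast_mulChar_mul_eq χ (μ s), sub_eq_add_neg]
    refine (Padic.nonarchimedean _ _).trans (max_le (hP s) ?_)
    rw [norm_neg]; exact hM s
  have h1sum : ∀ s : ℕ, ‖∑ b : ZMod ℓ, (1 : DirichletCharacter ℚ_[2] ℓ) b * μ s b‖ ≤ 2 := fun s ↦ by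
    rw [sum_one_mul_eq χ (μ s)]
    exact (Padic.nonarchimedean _ _).trans (max_le (hP s) (hM s))
  have hdsum : ∀ s : ℕ, ‖∑ b : ZMod ℓ, χQ b * μ s b - ∑ b : ZMod ℓ, (1 : DirichletCharacter ℚ_[2] ℓ) b * μ s b‖ ≤ 1 :=
    fun s ↦ by
    simp_rw [hχQapp]
    rw [sum_intCast_mulChar_mul_eq χ (μ s), sum_one_mul_eq χ (μ s)]
    have he : ∑ b ∈ Finset.univ.filter (fun b : ZMod ℓ ↦ χ b = 1), μ s b -
        ∑ b ∈ Finset.univ.filter (fun b : ZMod ℓ ↦ χ b = -1), μ s b -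
        (∑ b ∈ Finset.univ.filter (fun b : ZMod ℓ ↦ χ b = 1), μ s b +
          ∑ b ∈ Finset.univ.filter (fun b : ZMod ℓ ↦ χ b = -1), μ s b) =
        -((2 : ℚ_[2]) * ∑ b ∈ Finset.univ.filter (fun b : ZMod ℓ ↦ χ b = -1), μ s b) := by ring
    rw [he, norm_neg, norm_mul, h2]
    calc (2 : ℝ)⁻¹ * _ ≤ (2 : ℝ)⁻¹ * 2 := by gcongr; exact hM s
      _ = 1 := by norm_num
  -- binomial coefficients are integers
  have hC : ∀ s : ZMod (2 ^ n), ‖((s.val.choose k : ℕ) : ℚ_[2])‖ ≤ 1 := fun s ↦ by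
    have h := Padic.norm_int_le_one (p := 2) ((s.val.choose k : ℕ) : ℤ)
    rwa [Int.cast_natCast] at h
  -- the three Riemann-sum bounds
  have hRS : ∀ (ψ : DirichletCharacter ℚ_[2] ℓ) (hψ : ψ.Even) (C : ℝ) (_ : 0 ≤ C)
      (_ : ∀ s : ℕ, ‖∑ b : ZMod ℓ, ψ b * μ s b‖ ≤ C),
      ‖padicLRiemannSumTame f ℓ α ψ k n‖ ≤ ‖(2 : ℚ_[2])‖ * C := by
    intro ψ hψ C hC0 hψC
    rw [padicLRiemannSumTame_two_of_even f hℓ2 α ψ hψ, norm_mul]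
    gcongr
    refine IsUltrametricDist.norm_sum_le_of_forall_le_of_nonneg hC0 fun s _ ↦ ?_
    have hre : ∑ b : ZMod ℓ, ψ b * msdMeasureTame f ℓ α (n + 2)
        ((cyclotomicGenerator 2 : ZMod (2 ^ (n + 2))) ^ s.val) b * ((s.val.choose k : ℕ) : ℚ_[2]) =
        (∑ b : ZMod ℓ, ψ b * μ s.val b) * ((s.val.choose k : ℕ) : ℚ_[2]) := by
      rw [Finset.sum_mul]
    rw [hre, norm_mul]
    calc _ ≤ C * 1 := mul_le_mul (hψC s.val) (hC s) (norm_nonneg _) hC0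
      _ = C := mul_one _
  refine ⟨?_, ?_, ?_⟩
  · have h := hRS χQ hχQeven 2 zero_le_two hχsum
    rw [h2] at h; linarith
  · have h := hRS 1 h1even 2 zero_le_two h1sum
    rw [h2] at h; linarith
  · rw [padicLRiemannSumTame_two_of_even f hℓ2 α χQ hχQeven, padicLRiemannSumTame_two_of_even f hℓ2 α 1 h1even,
      ← mul_sub, norm_mul, ← Finset.sum_sub_distrib]
    calc ‖(2 : ℚ_[2])‖ * _ ≤ ‖(2 : ℚ_[2])‖ * 1 := by
          gcongr
          refine IsUltrametricDist.norm_sum_le_of_forall_le_of_nonneg zero_le_one fun s _ ↦ ?_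
          have hre : ∑ b : ZMod ℓ, χQ b * msdMeasureTame f ℓ α (n + 2)
              ((cyclotomicGenerator 2 : ZMod (2 ^ (n + 2))) ^ s.val) b * ((s.val.choose k : ℕ) : ℚ_[2]) -
              ∑ b : ZMod ℓ, (1 : DirichletCharacter ℚ_[2] ℓ) b * msdMeasureTame f ℓ α (n + 2)
              ((cyclotomicGenerator 2 : ZMod (2 ^ (n + 2))) ^ s.val) b * ((s.val.choose k : ℕ) : ℚ_[2]) =
              (∑ b : ZMod ℓ, χQ b * μ s.val b - ∑ b : ZMod ℓ, (1 : DirichletCharacter ℚ_[2] ℓ) b * μ s.val b) *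
                ((s.val.choose k : ℕ) : ℚ_[2]) := by
            simp only [hμ, sub_mul, Finset.sum_mul]
          rw [hre, norm_mul]
          calc _ ≤ (1 : ℝ) * 1 := mul_le_mul (hdsum s.val) (hC s) (norm_nonneg _) zero_le_one
            _ = 1 := mul_one _
      _ = ‖(2 : ℚ_[2])‖ := mul_one _

/-- **`L₂(f,α,χ) ≡ L₂(f,α,𝟙_ℓ) (mod 2Λ)` as reductions of integral lifts, both in `Λ`**, at a prime tame level `ℓ` with
`ℓ² ∣ N`, `a_ℓ(f) = 0` (`E[2]` irreducible supplies the odd Eisenstein multiple; Matsuno 2000 Lemma 3.2 at `p = 2` in the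
both-additive setting). [cite: Matsuno2000, Lemma 3.2 (p. 87)] [cite: MazurTateTeitelbaum1986Invent, §I.12–I.13 (pp. 17–19)] -/
theorem exists_iwasawa_pair_map_toZMod_eq_two_of_sq_dvd (hord : IsOrdinaryAt W 2) (hf : IsNewformOf W f)
    (hirr : W.HasIrreducibleModPGaloisRep 2) (hℓN : ℓ ^ 2 ∣ N) (haℓ : cuspCoeff f ℓ = 0)
    (χ : MulChar (ZMod ℓ) ℤ) (hχ : χ (-1) = 1) :
    ∃ G G₁ : IwasawaAlgebra 2,
      iwasawaToPowerSeries 2 G = padicLFunctionTame f ℓ (unitRoot W 2 : ℚ_[2])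
        ((χ.ringHomComp (Int.castRingHom ℚ)).ringHomComp (Rat.castHom ℚ_[2])) ∧
      iwasawaToPowerSeries 2 G₁ = padicLFunctionTame f ℓ (unitRoot W 2 : ℚ_[2]) (1 : DirichletCharacter ℚ_[2] ℓ) ∧
      PowerSeries.map (PadicInt.toZMod (p := 2)) G = PowerSeries.map (PadicInt.toZMod (p := 2)) G₁ := by
  have hℓ : ℓ.Prime := Fact.out
  have h2N : ¬ 2 ∣ N := not_dvd_level_of_isNewformOf hf hord.1
  have hℓ2 : ℓ.Coprime 2 := (Nat.coprime_primes hℓ Nat.prime_two).mpr (by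
    rintro rfl; exact h2N ((dvd_pow_self 2 two_ne_zero).trans hℓN))
  -- the odd Eisenstein prime `q`
  obtain ⟨q, hqF, -, hgood, hndvd⟩ := exists_prime_not_dvd_frobeniusTrace_sub
    not_irreducible_of_frobeniusTrace_congr_holds W 2 hirr
  have hqN : ¬ q ∣ N := not_dvd_level_of_isNewformOf hf hgood
  have haq : cuspCoeff f q = ((W.frobeniusTrace q : ℤ) : ℂ) := cuspCoeff_eq_frobeniusTrace_of_isNewformOf_holds hf hgood
  have hodd : ¬ (2 : ℤ) ∣ W.frobeniusTrace q - q - 1 := by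
    intro h; apply hndvd; push_cast; convert h using 1; ring
  set χQ : DirichletCharacter ℚ_[2] ℓ := (χ.ringHomComp (Int.castRingHom ℚ)).ringHomComp (Rat.castHom ℚ_[2]) with hχQ
  have h2 : ‖(2 : ℚ_[2])‖ = (2 : ℝ)⁻¹ := by
    have h := Padic.norm_p (p := 2); simpa using h
  have hcoef : ∀ k, ‖padicLCoeffTame f ℓ (unitRoot W 2 : ℚ_[2]) χQ k‖ ≤ 1 ∧
      ‖padicLCoeffTame f ℓ (unitRoot W 2 : ℚ_[2]) (1 : DirichletCharacter ℚ_[2] ℓ) k‖ ≤ 1 ∧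
      ‖padicLCoeffTame f ℓ (unitRoot W 2 : ℚ_[2]) χQ k -
        padicLCoeffTame f ℓ (unitRoot W 2 : ℚ_[2]) (1 : DirichletCharacter ℚ_[2] ℓ) k‖ ≤ ‖(2 : ℚ_[2])‖ := by
    intro k
    have hlimχ := tendsto_padicLRiemannSumTame_unitRoot_two hord hf hℓ2 χQ k
    have hlim1 := tendsto_padicLRiemannSumTame_unitRoot_two hord hf hℓ2 (1 : DirichletCharacter ℚ_[2] ℓ) k
    have hRS := fun n ↦ norm_padicLRiemannSumTame_le f hord hf hℓN haℓ hqN haq hodd χ hχ k n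
    exact ⟨le_of_tendsto hlimχ.norm (Eventually.of_forall fun n ↦ (hRS n).1),
      le_of_tendsto hlim1.norm (Eventually.of_forall fun n ↦ (hRS n).2.1),
      le_of_tendsto (hlimχ.sub hlim1).norm (Eventually.of_forall fun n ↦ (hRS n).2.2)⟩
  refine exists_iwasawa_pair_map_toZMod_eq _ _ (fun k ↦ ?_) (fun k ↦ ?_) (fun k ↦ ?_)
  · rw [coeff_padicLFunctionTame]; exact (hcoef k).1
  · rw [coeff_padicLFunctionTame]; exact (hcoef k).2.1
  · rw [coeff_padicLFunctionTame, coeff_padicLFunctionTame]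
    have h := (hcoef k).2.2
    rw [h2] at h; linarith

end Riemann

/-! ## §4 Depletion at a prime dividing the level with `a_ℓ = 0`, and the congruence with NO Euler factor -/

section Congruence

variable {N : ℕ} [NeZero N] (f : CuspForm (Gamma0 N) 2) {ℓ : ℕ} [Fact ℓ.Prime]
  {W : WeierstrassCurve ℚ} [W.IsElliptic] [W.IsGloballyMinimal]

omit [NeZero N] [Fact ℓ.Prime] [W.IsElliptic] [W.IsGloballyMinimal] in
/-- `(1+T)^{c}` is a unit of `Λ`; private helper. [folklore] -/
private theorem isUnit_binomialSeries {p : ℕ} [Fact p.Prime] (c : ℤ_[p]) :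
    IsUnit (PowerSeries.binomialSeries ℤ_[p] c) := by
  refine isUnit_iff_exists_inv.mpr ⟨PowerSeries.binomialSeries ℤ_[p] (-c), ?_⟩
  rw [← PowerSeries.binomialSeries_add, add_neg_cancel, PowerSeries.binomialSeries_zero]

/-- **The depletion at a prime `ℓ ∣ N` with `a_ℓ(f) = 0`: `L₂(f,α,𝟙_ℓ) = −(1+T)^{f_ℓ}·L₂(f,α)` in `Λ`** — Matsuno's Lemma 3.3
with `U_ℓ f = a_ℓ f = 0` (the tree's `iwasawaToPowerSeries_prod_tameEulerFactor_mul_sqfreeAt` at `S = {ℓ}`, `a ℓ = 0`): NO Euler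
factor survives, only the unit `−(1+T)^{f_ℓ}`. [cite: Matsuno2000, Lemma 3.3 (pp. 87–88)] [cite: MazurTateTeitelbaum1986Invent, §I.4 (4.2)] -/
theorem iwasawaToPowerSeries_neg_binomialSeries_mul_eq_padicLFunctionTame_one (hord : IsOrdinaryAt W 2)
    (hf : IsNewformOf W f) (hℓN : ℓ ^ 2 ∣ N) (haℓ : cuspCoeff f ℓ = 0) {LW : IwasawaAlgebra 2}
    (hLW : iwasawaToPowerSeries 2 LW = padicLFunction f (unitRoot W 2 : ℚ_[2])) :
    iwasawaToPowerSeries 2 (-PowerSeries.binomialSeries ℤ_[2] (frobeniusExponent 2 (ℓ : ℤ_[2])) * LW) =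
      padicLFunctionTame f ℓ (unitRoot W 2 : ℚ_[2]) (1 : DirichletCharacter ℚ_[2] ℓ) := by
  have hℓ : ℓ.Prime := Fact.out
  have h2N : ¬ 2 ∣ N := not_dvd_level_of_isNewformOf hf hord.1
  have hℓN' : ℓ ∣ N := (dvd_pow_self ℓ two_ne_zero).trans hℓN
  have hℓ2 : ℓ.Coprime 2 := (Nat.coprime_primes hℓ Nat.prime_two).mpr (by rintro rfl; exact h2N hℓN')
  obtain ⟨hαeq, hαu, -⟩ := unitRoot_coe_spec (W := W) hord
  obtain ⟨teich, hteich⟩ := exists_teichmuller_frobeniusExponent 2 hℓ2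
  have hS : ∀ ℓ' ∈ ({ℓ} : Finset ℕ), ℓ'.Prime ∧ ℓ'.Coprime 2 := fun ℓ' h ↦ by
    rw [Finset.mem_singleton] at h; subst h; exact ⟨hℓ, hℓ2⟩
  have ha : ∀ ℓ' ∈ ({ℓ} : Finset ℕ), cuspCoeff f ℓ' = (((fun _ : ℕ ↦ (0 : ℤ)) ℓ' : ℤ) : ℂ) := fun ℓ' h ↦ by
    rw [Finset.mem_singleton] at h; subst h; rw [haℓ]; simp
  have hc : ∀ ℓ' ∈ ({ℓ} : Finset ℕ), ∀ n : ℕ,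
      PadicInt.toZModPow (n + cyclotomicExponent 2) (((fun _ : ℕ ↦ teich) ℓ' : ℤ_[2]ˣ) : ℤ_[2]) *
        (cyclotomicGenerator 2 : ZMod (2 ^ (n + cyclotomicExponent 2))) ^
          (PadicInt.toZModPow n ((fun ℓ' : ℕ ↦ frobeniusExponent 2 (ℓ' : ℤ_[2])) ℓ')).val =
          (ℓ' : ZMod (2 ^ (n + cyclotomicExponent 2))) := fun ℓ' h n ↦ by
    rw [Finset.mem_singleton] at h; subst h; exact hteich n
  have hm : ℓ = ∏ ℓ' ∈ ({ℓ} : Finset ℕ), ℓ' := by rw [Finset.prod_singleton]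
  have h := iwasawaToPowerSeries_prod_tameEulerFactor_mul_sqfreeAt hf.1 hf.coeffField_eq_bot h2N
    (cuspCoeff_eq_frobeniusTrace_of_isNewformOf_holds hf hord.1) hαeq hαu hS ha hc hm hLW
  rw [Finset.prod_singleton, if_pos hℓN', Int.cast_zero, map_zero, zero_sub, sub_zero] at h
  exact h

/-- **THE CONGRUENCE AT A BOTH-ADDITIVE PRIME: `L₂(f,α,χ_ℓ) ≡ u·L₂(f,α) (mod 2Λ)`, `u ∈ Λˣ`, NO Euler factor.** For `E = W/ℚ`
globally minimal, good ordinary at `2`, with `E[2]` irreducible, `f` its newform (level `N`), an odd prime `ℓ` with `ℓ² ∣ N` and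
`a_ℓ(f) = 0`, and a `ℤ`-valued EVEN character `χ` mod `ℓ` (read in `ℚ₂`): there are `L_W, G ∈ Λ = ℤ₂⟦T⟧` and `u ∈ Λˣ` with
`ι L_W = L₂(f,α)`, `ι G = L₂(f,α,χ)` and `G ≡ u·L_W (mod 2)`. (§3: `L₂(f,α,χ) ≡ L₂(f,α,𝟙_ℓ)`; depletion with `a_ℓ = 0`:
`L₂(f,α,𝟙_ℓ) = −(1+T)^{f_ℓ} L₂(f,α)`.) The both-additive companion of `exists_iwasawa_padicLFunctionTame_congr_two_sqfreeAt`
(where `∏𝒫_v` appears): Matsuno 2000 Thm. 3.1 with `ε(ℓ) = 0`, `P_ℓ = 1`. [cite: Matsuno2000, Lemmas 3.2–3.3, Thm. 3.1 (pp. 86–88)]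
[cite: MazurTateTeitelbaum1986Invent, §I.12–I.13 (pp. 17–19)] -/
theorem exists_iwasawa_padicLFunctionTame_congr_two_of_sq_dvd (hord : IsOrdinaryAt W 2) (hf : IsNewformOf W f)
    (hirr : W.HasIrreducibleModPGaloisRep 2) (hℓN : ℓ ^ 2 ∣ N) (haℓ : cuspCoeff f ℓ = 0)
    (χ : MulChar (ZMod ℓ) ℤ) (hχ : χ (-1) = 1) :
    ∃ (LW G : IwasawaAlgebra 2) (u : (IwasawaAlgebra 2)ˣ),
      iwasawaToPowerSeries 2 LW = padicLFunction f (unitRoot W 2 : ℚ_[2]) ∧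
      iwasawaToPowerSeries 2 G = padicLFunctionTame f ℓ (unitRoot W 2 : ℚ_[2])
        ((χ.ringHomComp (Int.castRingHom ℚ)).ringHomComp (Rat.castHom ℚ_[2])) ∧
      PowerSeries.map (PadicInt.toZMod (p := 2)) G =
        PowerSeries.map (PadicInt.toZMod (p := 2)) ((u : IwasawaAlgebra 2) * LW) := by
  obtain ⟨LW, hLW⟩ := exists_iwasawaToPowerSeries_eq_padicLFunction_two_auto hord hf
  obtain ⟨G, G₁, hG, hG₁, hGG₁⟩ := exists_iwasawa_pair_map_toZMod_eq_two_of_sq_dvd f hord hf hirr hℓN haℓ χ hχ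
  have hdep := iwasawaToPowerSeries_neg_binomialSeries_mul_eq_padicLFunctionTame_one f hord hf hℓN haℓ hLW
  have hG₁eq : G₁ = -PowerSeries.binomialSeries ℤ_[2] (frobeniusExponent 2 (ℓ : ℤ_[2])) * LW :=
    iwasawaToPowerSeries_injective 2 (hG₁.trans hdep.symm)
  have hu := (isUnit_binomialSeries (frobeniusExponent 2 (ℓ : ℤ_[2]))).neg
  refine ⟨LW, G, hu.unit, hLW, hG, ?_⟩
  rw [hGG₁, hG₁eq, IsUnit.unit_spec]

end Congruence




end Summit.BirchSwinnertonDyer.BirchSwinnertonDyer.Theorems.AlignedTransportAtTwoAddTwistCongruence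

end
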